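import Summits.Parity.BatemanHorn.Theorems.RoughParitySectorsOddSectorShareNonlinearExactness

/-!
# Crux `OddSectorShareNonlinear` (stmt-Parity-15628): the split `BH_f = P_f ∧ A_f` is exact
# SYSTEM BY SYSTEM, and the crux alone is Bateman–Horn for nonlinear systems modulo their parity balance

Lead c2 of the line `registered` (prover-line-stmt-Parity-15628-c2-0, 2026-08-17).  Everything here is
PROVED (no `sorry`, no definition, no new fact).  It completes the "two out of three" kit of
`RoughParitySectorsOddSectorShareNonlinearExactness.lean` (lead c1) by the third per-system direction,
extracted from the route's deciding theorem `Theses.RoughParitySectors.closes` (whose hypotheses are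
GLOBAL — all systems — although its proof is local):

* `Exactness.asymptotic_of_balance_of_share` — `P_f ∧ A_f ⟹ BatemanHornAsymptotic f` for ONE
  Bateman–Horn system `f` (any degree profile), from the PROVED band
  `Cruxes.RoughValueLaw.IncrementAnchoring.stub_sieveBand`, staggered Mertens
  `Theorems.SieveCalibration.tendsto_log_pow_mul_staggeredProd` and the growth lemma
  `Theorems.BalancedSemiprimeLayer.Negative.exists_pow_le_two_mul_eval` — verbatim the argument of
  `closes`, localised;

whence, for one system, each of the three statements is EQUIVALENT to each other one given the third:

* `Exactness.share_iff_balance_of_asymptotic` — GIVEN `BatemanHornAsymptotic f`, the share statement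
  `A_f` (conclusion of this crux for `f`) is EQUIVALENT to the parity balance `P_f` (conclusion of the
  sibling crux `RoughParityBalance` for `f`): relative to Bateman–Horn along `f` the "parity-immune"
  share statement IS the parity bit — it is not reachable from `BH_f` by parity-blind means;
* `Exactness.share_iff_asymptotic_of_balance` — given `P_f`, `A_f ↔ BatemanHornAsymptotic f`;
* `Exactness.balance_iff_asymptotic_of_share` — given `A_f`, `P_f ↔ BatemanHornAsymptotic f`;

The crux-by-itself corollaries (`RoughParityBalance → (OddSectorShareNonlinear ↔ BH|nonlinear)`,
`BatemanHorn → (OddSectorShareNonlinear ↔ P|nonlinear)`, minimality) are in the companion file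
`RoughParitySectorsOddSectorShareNonlinearAlone.lean`.

Reading (census of the lead lineage c0/c1/c2): every instance of the crux contains an irreducible
member of degree `≥ 2`; by `share_iff_asymptotic_of_balance`, proving the crux proves "parity balance
of the rough values of `f` ⟹ Bateman–Horn for `f`" for every such `f`, and by
`share_iff_balance_of_asymptotic` not even Bateman–Horn for `f` would give it without the parity bit.
The crux is the route's honest open leaf (≡ Bateman–Horn for nonlinear systems modulo the sibling
parity crux), to be parked, not re-lined.

References: Bateman–Horn, Math. Comp. 16 (1962) (1)–(2) [BatemanHorn1962]; K. Alladi, Quart. J. Math.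
33 (1982) [Alladi1982]; Halberstam–Richert, *Sieve Methods* (1974), Thm 2.5 [HalberstamRichert1974];
E. Bombieri, The asymptotic sieve, Rend. Accad. Naz. XL (1976) [BombieriAsymptoticSieve1976].
-/

namespace Summit.Parity.BatemanHorn.Cruxes.OddSectorShareNonlinear.Birth

open Filter Finset Polynomial
open scoped Topology
open Literature.NumberTheory.Sieve
open Summit.Parity.BatemanHorn.Theses.RoughParitySectors

namespace Exactness

/-! ### The third direction, system by system -/

/-- **`P_f ∧ A_f ⟹ BH_f`, for ONE system.**  For a Bateman–Horn system `f` (any degree profile) whose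
jointly rough values satisfy the parity balance `|2^k·c_odd − #R| ≤ δ·#R` (`U ≥ U₀(δ)`, eventually)
and the odd-sector share `|c₁·(U e^{−γ}/2)^k − c_odd| ≤ η·c_odd` (`U ≥ U₀(η)`, eventually), the
Bateman–Horn asymptotic `polyPrimeCount f x ∼ (C(f)/∏ deg fᵢ)·x/(log x)^k` holds.  The proof is the
route's deciding theorem `closes` verbatim with its two global hypotheses replaced by the local ones:
the PROVED band `stub_sieveBand` and staggered Mertens give `#R`, the balance gives `c_odd`, the
share gives `c₁`, and `c₁ ↔ polyPrimeCount` is bookkeeping (`exists_pow_le_two_mul_eval`,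
`SieveBand.eventually_absorb`). [folklore] -/
theorem asymptotic_of_balance_of_share {k : ℕ} {f : Fin k → ℤ[X]} (hf : IsBatemanHornSystem f)
    (hPf : ∀ δ : ℝ, 0 < δ → ∃ U₀ : ℝ, ∀ U : ℝ, U₀ ≤ U → ∀ᶠ x : ℕ in Filter.atTop, |(2 : ℝ) ^ k *
      (((((Finset.Icc 1 x).filter (fun n : ℕ => ∀ i, 0 < (f i).eval (n : ℤ) ∧ ∀ p ∈ Finset.range ⌈(x
      : ℝ) ^ (((f i).natDegree : ℝ) / U)⌉₊, p.Prime → ¬ ((p : ℤ) ∣ (f i).eval (n : ℤ)))).filter (fun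
      n : ℕ => ∀ i, Odd (ArithmeticFunction.cardFactors (((f i).eval (n : ℤ)).toNat)))).card : ℕ) :
      ℝ) - ((((Finset.Icc 1 x).filter (fun n : ℕ => ∀ i, 0 < (f i).eval (n : ℤ) ∧ ∀ p ∈ Finset.range
      ⌈(x : ℝ) ^ (((f i).natDegree : ℝ) / U)⌉₊, p.Prime → ¬ ((p : ℤ) ∣ (f i).eval (n : ℤ)))).card :
      ℕ) : ℝ)| ≤ δ * ((((Finset.Icc 1 x).filter (fun n : ℕ => ∀ i, 0 < (f i).eval (n : ℤ) ∧ ∀ p ∈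
      Finset.range ⌈(x : ℝ) ^ (((f i).natDegree : ℝ) / U)⌉₊, p.Prime → ¬ ((p : ℤ) ∣ (f i).eval (n :
      ℤ)))).card : ℕ) : ℝ))
    (hAf : ∀ η : ℝ, 0 < η → ∃ U₀ : ℝ, ∀ U : ℝ, U₀ ≤ U → ∀ᶠ x : ℕ in Filter.atTop, |(((((Finset.Icc 1
      x).filter (fun n : ℕ => ∀ i, 0 < (f i).eval (n : ℤ) ∧ ∀ p ∈ Finset.range ⌈(x : ℝ) ^ (((f
      i).natDegree : ℝ) / U)⌉₊, p.Prime → ¬ ((p : ℤ) ∣ (f i).eval (n : ℤ)))).filter (fun n : ℕ => ∀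
      i, ArithmeticFunction.cardFactors (((f i).eval (n : ℤ)).toNat) = 1)).card : ℕ) : ℝ) * (U *
      Real.exp (-Real.eulerMascheroniConstant) / 2) ^ k - (((((Finset.Icc 1 x).filter (fun n : ℕ =>
      ∀ i, 0 < (f i).eval (n : ℤ) ∧ ∀ p ∈ Finset.range ⌈(x : ℝ) ^ (((f i).natDegree : ℝ) / U)⌉₊,
      p.Prime → ¬ ((p : ℤ) ∣ (f i).eval (n : ℤ)))).filter (fun n : ℕ => ∀ i, Odd
      (ArithmeticFunction.cardFactors (((f i).eval (n : ℤ)).toNat)))).card : ℕ) : ℝ)| ≤ η *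
      (((((Finset.Icc 1 x).filter (fun n : ℕ => ∀ i, 0 < (f i).eval (n : ℤ) ∧ ∀ p ∈ Finset.range ⌈(x
      : ℝ) ^ (((f i).natDegree : ℝ) / U)⌉₊, p.Prime → ¬ ((p : ℤ) ∣ (f i).eval (n : ℤ)))).filter (fun
      n : ℕ => ∀ i, Odd (ArithmeticFunction.cardFactors (((f i).eval (n : ℤ)).toNat)))).card : ℕ) :
      ℝ)) :
    BatemanHornAsymptotic f := by
  obtain ⟨hC, hC0⟩ := Literature.NumberTheory.Sieve.IsBatemanHornSystem.hasBatemanHornConst_holds hf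
  refine ⟨_, hC, ?_⟩
  obtain ⟨m, hm⟩ : ∃ m : ℝ, m = Literature.NumberTheory.Sieve.batemanHornConst f /
      ∏ i, ((f i).natDegree : ℝ) := ⟨_, rfl⟩
  have hm0 : 0 < m := by
    rw [hm]; exact div_pos hC0 (Finset.prod_pos fun i _ => by exact_mod_cast hf.natDegree_pos i)
  rw [← hm, Fintype.card_fin]
  -- growth thresholds (n ^ deg fᵢ ≤ 2 fᵢ(n) for n ≥ M i) and the degree bound
  choose M hM using fun i =>
    Theorems.BalancedSemiprimeLayer.Negative.exists_pow_le_two_mul_eval (hf.leadingCoeff_pos i)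
  have hdS : ∀ i, ((f i).natDegree : ℝ) ≤ (Finset.univ.sup fun i => (f i).natDegree : ℕ) := fun i => by
    exact_mod_cast Finset.le_sup (f := fun i => (f i).natDegree) (Finset.mem_univ i)
  -- the prime cell inside `polyPrimeCount`, and the complement: n = 0, n < M i, or n ≤ 2 fᵢ(n) < 2⌈x^{1/4}⌉₊
  have hE : ∀ (U : ℝ) (x : ℕ), 4 * ((Finset.univ.sup fun i => (f i).natDegree : ℕ) : ℝ) + 1 ≤ U →
      2 ≤ x → ∀ s : Finset ℕ, s = ((Finset.Icc 1 x).filter (fun n : ℕ => ∀ i, 0 < (f i).eval (n : ℤ) ∧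
        ∀ p ∈ Finset.range ⌈(x : ℝ) ^ (((f i).natDegree : ℝ) / U)⌉₊, p.Prime →
          ¬ ((p : ℤ) ∣ (f i).eval (n : ℤ)))).filter
        (fun n : ℕ => ∀ i, ArithmeticFunction.cardFactors (((f i).eval (n : ℤ)).toNat) = 1) →
      s.card ≤ Literature.NumberTheory.Sieve.polyPrimeCount f x ∧
        Literature.NumberTheory.Sieve.polyPrimeCount f x ≤ (s ∪ (Finset.range (1 + Finset.univ.sup M) ∪
          Finset.range (2 * ⌈(x : ℝ) ^ (1 / 4 : ℝ)⌉₊))).card := by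
    rintro U x hU hx s rfl
    have hP' : Literature.NumberTheory.Sieve.polyPrimeCount f x = ((Finset.range (x + 1)).filter
        fun n : ℕ => ∀ i, 0 < (f i).eval (n : ℤ) ∧ ((f i).eval (n : ℤ)).toNat.Prime).card := by
      unfold Literature.NumberTheory.Sieve.polyPrimeCount; congr
    rw [hP']
    have hx1 : (1 : ℝ) ≤ x := by exact_mod_cast (by omega : 1 ≤ x)
    have hU0 : 0 < U := by
      linarith [Nat.cast_nonneg (α := ℝ) (Finset.univ.sup fun i => (f i).natDegree)]
    constructor
    · exact Finset.card_le_card fun n hn => by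
        rw [Finset.mem_filter, Finset.mem_filter, Finset.mem_Icc] at hn
        exact Finset.mem_filter.2 ⟨Finset.mem_range.2 (by omega), fun i => ⟨(hn.1.2 i).1,
          ArithmeticFunction.cardFactors_eq_one_iff_prime.1 (hn.2 i)⟩⟩
    · refine Finset.card_le_card fun n hn => ?_
      rw [Finset.mem_filter, Finset.mem_range] at hn
      obtain ⟨hnx, hn⟩ := hn
      by_contra hc
      rw [Finset.mem_union, Finset.mem_union, Finset.mem_range, Finset.mem_range, not_or, not_or,
        not_lt, not_lt] at hc
      obtain ⟨hc, hKn, hZn⟩ := hc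
      refine hc (Finset.mem_filter.2 ⟨Finset.mem_filter.2 ⟨Finset.mem_Icc.2 ⟨by omega, by omega⟩,
        fun i => ⟨(hn i).1, fun p hp hpp hpd => ?_⟩⟩,
        fun i => ArithmeticFunction.cardFactors_eq_one_iff_prime.2 (hn i).2⟩)
      obtain ⟨h0, hq⟩ := hn i
      have hpq : p = ((f i).eval (n : ℤ)).toNat := (Nat.prime_dvd_prime_iff_eq hpp hq).1
        (by rwa [← Int.natCast_dvd_natCast, Int.toNat_of_nonneg h0.le])
      have hpe : (p : ℤ) = (f i).eval (n : ℤ) := by rw [hpq, Int.toNat_of_nonneg h0.le]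
      have h1 := hM i n ((Finset.le_sup (f := M) (Finset.mem_univ i)).trans (by omega))
      have h2 : (n : ℤ) ≤ (n : ℤ) ^ (f i).natDegree := by
        exact_mod_cast Nat.le_self_pow (hf.natDegree_pos i).ne' n
      have h3 : p < ⌈(x : ℝ) ^ (1 / 4 : ℝ)⌉₊ := (Finset.mem_range.1 hp).trans_le (Nat.ceil_mono
        (Real.rpow_le_rpow_of_exponent_le hx1 (by rw [div_le_iff₀ hU0]; linarith [hdS i])))
      omega
  -- the iterated limit `x → ∞` then `U → ∞`, as one eventual bound for each τ ≤ 1/8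
  have key : ∀ τ : ℝ, 0 < τ → τ ≤ 1 / 8 → ∀ᶠ x : ℕ in atTop,
      |(Literature.NumberTheory.Sieve.polyPrimeCount f x : ℝ) * Real.log x ^ k / x - m| ≤
        τ * (8 * m + 1) := by
    intro τ hτ hτ1
    obtain ⟨U₁, h₁⟩ := hPf τ hτ
    obtain ⟨U₂, h₂⟩ := hAf τ hτ
    obtain ⟨U₃, h₃⟩ := Cruxes.RoughValueLaw.IncrementAnchoring.stub_sieveBand k f hf τ hτ
    obtain ⟨U, hU₁, hU₂, hU₃, hU⟩ : ∃ U : ℝ, U₁ ≤ U ∧ U₂ ≤ U ∧ U₃ ≤ U ∧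
        4 * ((Finset.univ.sup fun i => (f i).natDegree : ℕ) : ℝ) + 1 ≤ U :=
      ⟨max (max U₁ U₂) (max U₃ (4 * ((Finset.univ.sup fun i => (f i).natDegree : ℕ) : ℝ) + 1)),
        by simp, by simp, by simp, by simp⟩
    have hU0 : 0 < U := by
      linarith [Nat.cast_nonneg (α := ℝ) (Finset.univ.sup fun i => (f i).natDegree)]
    have hV := Theorems.SieveCalibration.tendsto_log_pow_mul_staggeredProd k f hf U
      (fun i => by linarith [hdS i])
    obtain ⟨B, hB⟩ : ∃ B : ℝ, B = m * Real.exp (-((k : ℝ) * Real.eulerMascheroniConstant)) * U ^ k :=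
      ⟨_, rfl⟩
    rw [← hm, ← hB] at hV
    have hB0 : 0 < B := by rw [hB]; positivity
    have hG0 : (0 : ℝ) < 2 ^ k * (U * Real.exp (-Real.eulerMascheroniConstant) / 2) ^ k := by positivity
    have hid : (2 : ℝ) ^ k * (U * Real.exp (-Real.eulerMascheroniConstant) / 2) ^ k =
        Real.exp (-((k : ℝ) * Real.eulerMascheroniConstant)) * U ^ k := by
      rw [neg_mul_eq_mul_neg, Real.exp_nat_mul, ← mul_pow, ← mul_pow]; congr 1; ring
    -- one link of the relative-error chain, and the final cancellation
    have step : ∀ a b s Q c : ℝ, |a - b| ≤ τ * b → 0 ≤ s → 0 ≤ Q → 0 ≤ c → c ≤ 1 →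
        (1 - c) * Q ≤ s * b → s * b ≤ (1 + c) * Q →
        (1 - (c + 2 * τ)) * Q ≤ s * a ∧ s * a ≤ (1 + (c + 2 * τ)) * Q := by
      intro a b s Q c hab hs hQ hc0 hc1 hl hu
      rw [abs_le] at hab
      have h1 : s * ((1 - τ) * b) ≤ s * a := mul_le_mul_of_nonneg_left (by linarith) hs
      have h2 : s * a ≤ s * ((1 + τ) * b) := mul_le_mul_of_nonneg_left (by linarith) hs
      have h3 : (1 - τ) * ((1 - c) * Q) ≤ (1 - τ) * (s * b) := mul_le_mul_of_nonneg_left hl (by linarith)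
      have h4 : (1 + τ) * (s * b) ≤ (1 + τ) * ((1 + c) * Q) := mul_le_mul_of_nonneg_left hu (by linarith)
      have h5 : τ * Q * c ≤ τ * Q := mul_le_of_le_one_right (by positivity) hc1
      have h6 : 0 ≤ τ * Q * c := by positivity
      constructor <;> linarith
    have cancel : ∀ L P C A X c : ℝ, 0 < P * A → (1 - c) * (X * (P * A)) ≤ L * P * (C * A) →
        L * P * (C * A) ≤ (1 + c) * (X * (P * A)) → (1 - c) * X ≤ C * L ∧ C * L ≤ (1 + c) * X := by
      intro L P C A X c h0 hl hu
      exact ⟨le_of_mul_le_mul_right (by linarith) h0, le_of_mul_le_mul_right (by linarith) h0⟩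
    have habs := Cruxes.RoughValueLaw.IncrementAnchoring.SieveBand.eventually_absorb k
      (Finset.univ.sup M + 3) (half_pos hτ)
    filter_upwards [h₁ U hU₁, h₂ U hU₂, h₃ U hU₃, Metric.tendsto_nhds.1 hV _ (mul_pos hτ hB0), habs,
      eventually_ge_atTop 2] with x ha hb hc hd habsx hx2
    have hx1 : (1 : ℝ) ≤ x := by exact_mod_cast (by omega : 1 ≤ x)
    have hX : (0 : ℝ) < x := by linarith
    have hL0 : 0 < Real.log x ^ k := pow_pos (Real.log_pos (by exact_mod_cast hx2)) k
    rw [Real.dist_eq] at hd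
    -- the chain x·B → x·(log x)^k·V → (log x)^k·#R → (log x)^k·2^k·c_odd → (log x)^k·2^k·(c₁·A)
    obtain ⟨l1, u1⟩ := step _ _ (x : ℝ) ((x : ℝ) * B) 0 hd.le hX.le (by positivity) le_rfl (by norm_num)
      (by rw [sub_zero, one_mul]) (by rw [add_zero, one_mul])
    obtain ⟨l2, u2⟩ := step _ _ _ _ _ hc hL0.le (by positivity) (by linarith) (by linarith)
      (l1.trans_eq (mul_left_comm _ _ _)) ((mul_left_comm _ _ _).trans_le u1)
    obtain ⟨l3, u3⟩ := step _ _ _ _ _ ha hL0.le (by positivity) (by linarith) (by linarith) l2 u2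
    obtain ⟨l4, u4⟩ := step _ _ _ _ _ hb (by positivity) (by positivity) (by linarith) (by linarith)
      (l3.trans_eq (mul_assoc _ _ _).symm) ((mul_assoc _ _ _).trans_le u3)
    have hQ : (x : ℝ) * B = x * m * (2 ^ k * (U * Real.exp (-Real.eulerMascheroniConstant) / 2) ^ k) := by
      rw [hB, hid]; ring
    rw [hQ] at l4 u4
    obtain ⟨f1, f2⟩ := cancel _ _ _ _ _ _ hG0 l4 u4
    -- the prime cell versus `polyPrimeCount`
    obtain ⟨hE1, hE2⟩ := hE U x hU hx2 _ rfl
    replace hE2 := (hE2.trans (Finset.card_union_le _ _)).trans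
      (Nat.add_le_add_left (Finset.card_union_le _ _) _)
    rw [Finset.card_range, Finset.card_range] at hE2
    have hE1' := mul_le_mul_of_nonneg_right (Nat.cast_le (α := ℝ) |>.2 hE1) hL0.le
    have hE2' := mul_le_mul_of_nonneg_right (Nat.cast_le (α := ℝ) |>.2 hE2) hL0.le
    have hr1 : (1 : ℝ) ≤ (x : ℝ) ^ (1 / 4 : ℝ) := Real.one_le_rpow hx1 (by norm_num)
    have hr2 : (x : ℝ) ^ (1 / 4 : ℝ) * Real.log x ^ k ≤ ((x : ℝ) ^ (1 / 4 : ℝ)) ^ 2 * Real.log x ^ k :=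
      mul_le_mul_of_nonneg_right (by rw [sq]; exact le_mul_of_one_le_left (by positivity) hr1) hL0.le
    have hZ : (⌈(x : ℝ) ^ (1 / 4 : ℝ)⌉₊ : ℝ) * Real.log x ^ k ≤ ((x : ℝ) ^ (1 / 4 : ℝ) + 1) * Real.log x ^ k :=
      mul_le_mul_of_nonneg_right (Nat.ceil_lt_add_one (by positivity)).le hL0.le
    have hSL : (0 : ℝ) ≤ (Finset.univ.sup M + 3 : ℕ) * Real.log x ^ k := by positivity
    simp only [Nat.cast_add, Nat.cast_mul, Nat.cast_one, Nat.cast_ofNat] at hE2' habsx hSL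
    have hτx := mul_pos hτ hX
    rw [abs_sub_le_iff, sub_le_iff_le_add, div_le_iff₀ hX, sub_le_comm, le_div_iff₀ hX]
    constructor <;> linarith
  -- `key` ⇒ `P_f(x) ~ m · x / (log x)^k`
  rw [Asymptotics.IsEquivalent, Asymptotics.isLittleO_iff]
  intro c hc
  have h8 : (0 : ℝ) < 8 * m + 1 := by positivity
  filter_upwards [key (min (1 / 8) (c * m / (8 * m + 1))) (lt_min (by norm_num) (by positivity))
    (min_le_left _ _), eventually_gt_atTop 1] with x hx hx1
  have hX : (0 : ℝ) < x := by exact_mod_cast zero_lt_one.trans hx1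
  have hL : 0 < Real.log x ^ k := pow_pos (Real.log_pos (by exact_mod_cast hx1)) k
  have hX0 := hX.ne'
  have hL1 := hL.ne'
  have hkey : |(Literature.NumberTheory.Sieve.polyPrimeCount f x : ℝ) * Real.log x ^ k / x - m| ≤ c * m :=
    hx.trans ((mul_le_mul_of_nonneg_right (min_le_right _ _) h8.le).trans_eq
      (div_mul_cancel₀ _ h8.ne'))
  simp only [Pi.sub_apply, Real.norm_eq_abs]
  rw [abs_of_pos (by positivity : (0 : ℝ) < m * x / Real.log x ^ k)]
  have e1 : (Literature.NumberTheory.Sieve.polyPrimeCount f x : ℝ) - m * x / Real.log x ^ k =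
      x / Real.log x ^ k *
        ((Literature.NumberTheory.Sieve.polyPrimeCount f x : ℝ) * Real.log x ^ k / x - m) := by
    field_simp
  rw [e1, abs_mul, abs_of_pos (by positivity : (0 : ℝ) < x / Real.log x ^ k)]
  calc (x : ℝ) / Real.log x ^ k * _ ≤ x / Real.log x ^ k * (c * m) :=
        mul_le_mul_of_nonneg_left hkey (by positivity)
    _ = c * (m * x / Real.log x ^ k) := by ring

/-! ### Each of the three is equivalent to each other one given the third -/

/-- **Given Bateman–Horn along `f`, the share statement IS the parity balance**:
`BatemanHornAsymptotic f → (A_f ↔ P_f)`.  So the crux for `f` is not reachable from `BH_f` by any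
parity-blind argument: relative to `BH_f` it carries exactly the parity bit of the rough values of
`f`. [folklore] -/
theorem share_iff_balance_of_asymptotic {k : ℕ} {f : Fin k → ℤ[X]} (hf : IsBatemanHornSystem f)
    (hBH : BatemanHornAsymptotic f) :
    (∀ η : ℝ, 0 < η → ∃ U₀ : ℝ, ∀ U : ℝ, U₀ ≤ U → ∀ᶠ x : ℕ in Filter.atTop, |(((((Finset.Icc 1
      x).filter (fun n : ℕ => ∀ i, 0 < (f i).eval (n : ℤ) ∧ ∀ p ∈ Finset.range ⌈(x : ℝ) ^ (((f
      i).natDegree : ℝ) / U)⌉₊, p.Prime → ¬ ((p : ℤ) ∣ (f i).eval (n : ℤ)))).filter (fun n : ℕ => ∀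
      i, ArithmeticFunction.cardFactors (((f i).eval (n : ℤ)).toNat) = 1)).card : ℕ) : ℝ) * (U *
      Real.exp (-Real.eulerMascheroniConstant) / 2) ^ k - (((((Finset.Icc 1 x).filter (fun n : ℕ =>
      ∀ i, 0 < (f i).eval (n : ℤ) ∧ ∀ p ∈ Finset.range ⌈(x : ℝ) ^ (((f i).natDegree : ℝ) / U)⌉₊,
      p.Prime → ¬ ((p : ℤ) ∣ (f i).eval (n : ℤ)))).filter (fun n : ℕ => ∀ i, Odd
      (ArithmeticFunction.cardFactors (((f i).eval (n : ℤ)).toNat)))).card : ℕ) : ℝ)| ≤ η *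
      (((((Finset.Icc 1 x).filter (fun n : ℕ => ∀ i, 0 < (f i).eval (n : ℤ) ∧ ∀ p ∈ Finset.range ⌈(x
      : ℝ) ^ (((f i).natDegree : ℝ) / U)⌉₊, p.Prime → ¬ ((p : ℤ) ∣ (f i).eval (n : ℤ)))).filter (fun
      n : ℕ => ∀ i, Odd (ArithmeticFunction.cardFactors (((f i).eval (n : ℤ)).toNat)))).card : ℕ) :
      ℝ)) ↔
    (∀ δ : ℝ, 0 < δ → ∃ U₀ : ℝ, ∀ U : ℝ, U₀ ≤ U → ∀ᶠ x : ℕ in Filter.atTop, |(2 : ℝ) ^ k *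
      (((((Finset.Icc 1 x).filter (fun n : ℕ => ∀ i, 0 < (f i).eval (n : ℤ) ∧ ∀ p ∈ Finset.range ⌈(x
      : ℝ) ^ (((f i).natDegree : ℝ) / U)⌉₊, p.Prime → ¬ ((p : ℤ) ∣ (f i).eval (n : ℤ)))).filter (fun
      n : ℕ => ∀ i, Odd (ArithmeticFunction.cardFactors (((f i).eval (n : ℤ)).toNat)))).card : ℕ) :
      ℝ) - ((((Finset.Icc 1 x).filter (fun n : ℕ => ∀ i, 0 < (f i).eval (n : ℤ) ∧ ∀ p ∈ Finset.range
      ⌈(x : ℝ) ^ (((f i).natDegree : ℝ) / U)⌉₊, p.Prime → ¬ ((p : ℤ) ∣ (f i).eval (n : ℤ)))).card :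
      ℕ) : ℝ)| ≤ δ * ((((Finset.Icc 1 x).filter (fun n : ℕ => ∀ i, 0 < (f i).eval (n : ℤ) ∧ ∀ p ∈
      Finset.range ⌈(x : ℝ) ^ (((f i).natDegree : ℝ) / U)⌉₊, p.Prime → ¬ ((p : ℤ) ∣ (f i).eval (n :
      ℤ)))).card : ℕ) : ℝ)) :=
  ⟨balance_of_asymptotic_of_share hf hBH, share_of_asymptotic_of_balance hf hBH⟩

/-- **Given the parity balance of the rough values of `f`, the share statement IS Bateman–Horn for
`f`**: `P_f → (A_f ↔ BatemanHornAsymptotic f)`. [folklore] -/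
theorem share_iff_asymptotic_of_balance {k : ℕ} {f : Fin k → ℤ[X]} (hf : IsBatemanHornSystem f)
    (hPf : ∀ δ : ℝ, 0 < δ → ∃ U₀ : ℝ, ∀ U : ℝ, U₀ ≤ U → ∀ᶠ x : ℕ in Filter.atTop, |(2 : ℝ) ^ k *
      (((((Finset.Icc 1 x).filter (fun n : ℕ => ∀ i, 0 < (f i).eval (n : ℤ) ∧ ∀ p ∈ Finset.range ⌈(x
      : ℝ) ^ (((f i).natDegree : ℝ) / U)⌉₊, p.Prime → ¬ ((p : ℤ) ∣ (f i).eval (n : ℤ)))).filter (fun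
      n : ℕ => ∀ i, Odd (ArithmeticFunction.cardFactors (((f i).eval (n : ℤ)).toNat)))).card : ℕ) :
      ℝ) - ((((Finset.Icc 1 x).filter (fun n : ℕ => ∀ i, 0 < (f i).eval (n : ℤ) ∧ ∀ p ∈ Finset.range
      ⌈(x : ℝ) ^ (((f i).natDegree : ℝ) / U)⌉₊, p.Prime → ¬ ((p : ℤ) ∣ (f i).eval (n : ℤ)))).card :
      ℕ) : ℝ)| ≤ δ * ((((Finset.Icc 1 x).filter (fun n : ℕ => ∀ i, 0 < (f i).eval (n : ℤ) ∧ ∀ p ∈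
      Finset.range ⌈(x : ℝ) ^ (((f i).natDegree : ℝ) / U)⌉₊, p.Prime → ¬ ((p : ℤ) ∣ (f i).eval (n :
      ℤ)))).card : ℕ) : ℝ)) :
    (∀ η : ℝ, 0 < η → ∃ U₀ : ℝ, ∀ U : ℝ, U₀ ≤ U → ∀ᶠ x : ℕ in Filter.atTop, |(((((Finset.Icc 1
      x).filter (fun n : ℕ => ∀ i, 0 < (f i).eval (n : ℤ) ∧ ∀ p ∈ Finset.range ⌈(x : ℝ) ^ (((f
      i).natDegree : ℝ) / U)⌉₊, p.Prime → ¬ ((p : ℤ) ∣ (f i).eval (n : ℤ)))).filter (fun n : ℕ => ∀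
      i, ArithmeticFunction.cardFactors (((f i).eval (n : ℤ)).toNat) = 1)).card : ℕ) : ℝ) * (U *
      Real.exp (-Real.eulerMascheroniConstant) / 2) ^ k - (((((Finset.Icc 1 x).filter (fun n : ℕ =>
      ∀ i, 0 < (f i).eval (n : ℤ) ∧ ∀ p ∈ Finset.range ⌈(x : ℝ) ^ (((f i).natDegree : ℝ) / U)⌉₊,
      p.Prime → ¬ ((p : ℤ) ∣ (f i).eval (n : ℤ)))).filter (fun n : ℕ => ∀ i, Odd
      (ArithmeticFunction.cardFactors (((f i).eval (n : ℤ)).toNat)))).card : ℕ) : ℝ)| ≤ η *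
      (((((Finset.Icc 1 x).filter (fun n : ℕ => ∀ i, 0 < (f i).eval (n : ℤ) ∧ ∀ p ∈ Finset.range ⌈(x
      : ℝ) ^ (((f i).natDegree : ℝ) / U)⌉₊, p.Prime → ¬ ((p : ℤ) ∣ (f i).eval (n : ℤ)))).filter (fun
      n : ℕ => ∀ i, Odd (ArithmeticFunction.cardFactors (((f i).eval (n : ℤ)).toNat)))).card : ℕ) :
      ℝ)) ↔
    BatemanHornAsymptotic f :=
  ⟨asymptotic_of_balance_of_share hf hPf, fun hBH => share_of_asymptotic_of_balance hf hBH hPf⟩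

/-- **Given the share statement for `f`, the parity balance IS Bateman–Horn for `f`**:
`A_f → (P_f ↔ BatemanHornAsymptotic f)`. [folklore] -/
theorem balance_iff_asymptotic_of_share {k : ℕ} {f : Fin k → ℤ[X]} (hf : IsBatemanHornSystem f)
    (hAf : ∀ η : ℝ, 0 < η → ∃ U₀ : ℝ, ∀ U : ℝ, U₀ ≤ U → ∀ᶠ x : ℕ in Filter.atTop, |(((((Finset.Icc 1
      x).filter (fun n : ℕ => ∀ i, 0 < (f i).eval (n : ℤ) ∧ ∀ p ∈ Finset.range ⌈(x : ℝ) ^ (((f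
      i).natDegree : ℝ) / U)⌉₊, p.Prime → ¬ ((p : ℤ) ∣ (f i).eval (n : ℤ)))).filter (fun n : ℕ => ∀
      i, ArithmeticFunction.cardFactors (((f i).eval (n : ℤ)).toNat) = 1)).card : ℕ) : ℝ) * (U *
      Real.exp (-Real.eulerMascheroniConstant) / 2) ^ k - (((((Finset.Icc 1 x).filter (fun n : ℕ =>
      ∀ i, 0 < (f i).eval (n : ℤ) ∧ ∀ p ∈ Finset.range ⌈(x : ℝ) ^ (((f i).natDegree : ℝ) / U)⌉₊,
      p.Prime → ¬ ((p : ℤ) ∣ (f i).eval (n : ℤ)))).filter (fun n : ℕ => ∀ i, Odd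
      (ArithmeticFunction.cardFactors (((f i).eval (n : ℤ)).toNat)))).card : ℕ) : ℝ)| ≤ η *
      (((((Finset.Icc 1 x).filter (fun n : ℕ => ∀ i, 0 < (f i).eval (n : ℤ) ∧ ∀ p ∈ Finset.range ⌈(x
      : ℝ) ^ (((f i).natDegree : ℝ) / U)⌉₊, p.Prime → ¬ ((p : ℤ) ∣ (f i).eval (n : ℤ)))).filter (fun
      n : ℕ => ∀ i, Odd (ArithmeticFunction.cardFactors (((f i).eval (n : ℤ)).toNat)))).card : ℕ) :
      ℝ)) :
    (∀ δ : ℝ, 0 < δ → ∃ U₀ : ℝ, ∀ U : ℝ, U₀ ≤ U → ∀ᶠ x : ℕ in Filter.atTop, |(2 : ℝ) ^ k *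
      (((((Finset.Icc 1 x).filter (fun n : ℕ => ∀ i, 0 < (f i).eval (n : ℤ) ∧ ∀ p ∈ Finset.range ⌈(x
      : ℝ) ^ (((f i).natDegree : ℝ) / U)⌉₊, p.Prime → ¬ ((p : ℤ) ∣ (f i).eval (n : ℤ)))).filter (fun
      n : ℕ => ∀ i, Odd (ArithmeticFunction.cardFactors (((f i).eval (n : ℤ)).toNat)))).card : ℕ) :
      ℝ) - ((((Finset.Icc 1 x).filter (fun n : ℕ => ∀ i, 0 < (f i).eval (n : ℤ) ∧ ∀ p ∈ Finset.range
      ⌈(x : ℝ) ^ (((f i).natDegree : ℝ) / U)⌉₊, p.Prime → ¬ ((p : ℤ) ∣ (f i).eval (n : ℤ)))).card :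
      ℕ) : ℝ)| ≤ δ * ((((Finset.Icc 1 x).filter (fun n : ℕ => ∀ i, 0 < (f i).eval (n : ℤ) ∧ ∀ p ∈
      Finset.range ⌈(x : ℝ) ^ (((f i).natDegree : ℝ) / U)⌉₊, p.Prime → ¬ ((p : ℤ) ∣ (f i).eval (n :
      ℤ)))).card : ℕ) : ℝ)) ↔
    BatemanHornAsymptotic f :=
  ⟨fun hPf => asymptotic_of_balance_of_share hf hPf hAf,
    fun hBH => balance_of_asymptotic_of_share hf hBH hAf⟩

end Exactness

end Summit.Parity.BatemanHorn.Cruxes.OddSectorShareNonlinear.Birth
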